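import Literature.ModelTheory.ExponentialFields.DefinablyCompleteChainRule
import HarnessLib

/-!
# Gradients of coordinates, of one-variable functions of a coordinate, and of products

Topic `Literature/ModelTheory/ExponentialFields`.  Continuation of the norm-free `C¹` calculus on
`Kⁿ` over an ordered field (`DefinablyCompleteMeanValue.lean`, `DefinablyCompleteChainRule.lean`),
supplying the rules by which the terms of `L_exp` — polynomials in the coordinates and `exp` of
coordinates — are differentiable with the expected gradients in every model of `OEF ∪ [DC]`:

* `hasLinDerivAt_apply` — the coordinate function `y ↦ yᵢ` has gradient `eᵢ`;
* **`HasFieldDerivAt.hasLinDerivAt_comp_apply`** — if `φ : K → K` has derivative `φ'` at `xᵢ`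
  then `y ↦ φ (yᵢ)` has gradient `φ' eᵢ` at `x` (e.g. `y ↦ exp yᵢ`, by `IsOrderedExp.hasFieldDerivAt`);
* **`HasLinDerivAt.mul`** — the product rule, gradient `f₁(x) g₂ + f₂(x) g₁`;
* `HasLinDerivAt.sub` — difference rule.

Pure `ε`–`δ` calculus; no definable completeness needed.  Everything is proved; no definitions.

## References

* A. Fornasiero, T. Servi, *Definably complete Baire structures*, Fund. Math. 209 (2010),
  §1.2. [FornasieroServi2010]
-/

open Set Function
open _root_.Filter _root_.Topology

namespace Literature.ModelTheory.ExponentialFields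

variable {K : Type*} [Field K] [LinearOrder K] [IsStrictOrderedRing K] [TopologicalSpace K]
  [OrderTopology K] {n : ℕ}

/-! ### Coordinates and one-variable functions of a coordinate -/

omit [TopologicalSpace K] [OrderTopology K] in
/-- The coordinate function `y ↦ yᵢ` has gradient `eᵢ`. [folklore] -/
theorem hasLinDerivAt_apply (i : Fin n) (x : Fin n → K) :
    HasLinDerivAt (fun y => y i) (Pi.single i 1) x := by
  intro ε hε
  refine ⟨1, one_pos, fun h _ => ?_⟩
  have hsum : ∑ j, (Pi.single i 1 : Fin n → K) j * h j = h i := by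
    rw [Finset.sum_eq_single i]
    · simp
    · intro j _ hj; simp [hj]
    · intro hh; exact absurd (Finset.mem_univ i) hh
  rw [hsum]
  simp only [Pi.add_apply, add_sub_cancel_left, sub_self, abs_zero]
  exact mul_nonneg hε.le (Finset.sum_nonneg fun j _ => abs_nonneg _)

omit [TopologicalSpace K] [OrderTopology K] in
/-- `|hᵢ| ≤ Σⱼ |hⱼ|`. [folklore] -/
theorem abs_apply_le_sum_abs (h : Fin n → K) (i : Fin n) : |h i| ≤ ∑ j, |h j| :=
  Finset.single_le_sum (f := fun j => |h j|) (fun _ _ => abs_nonneg _) (Finset.mem_univ i)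

/-- **A one-variable function of a coordinate**: if `φ` has field derivative `φ'` at `xᵢ`, then
`y ↦ φ (yᵢ)` has gradient `φ' · eᵢ` at `x`. [folklore] -/
theorem HasFieldDerivAt.hasLinDerivAt_comp_apply {φ : K → K} {φ' : K} {x : Fin n → K}
    {i : Fin n} (hφ : HasFieldDerivAt φ φ' (x i)) :
    HasLinDerivAt (fun y => φ (y i)) (Pi.single i φ') x := by
  intro ε hε
  rw [hasFieldDerivAt_iff, LinearOrderedAddCommGroup.tendsto_nhds] at hφ
  have hev := hφ ε hε
  rw [eventually_nhdsWithin_iff] at hev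
  obtain ⟨δ, hδ, hδε⟩ : ∃ δ : K, 0 < δ ∧ ∀ s, |s - x i| < δ → s ≠ x i →
      |(φ s - φ (x i)) / (s - x i) - φ'| < ε := by
    have h := (LinearOrderedAddCommGroup.tendsto_nhds.1 tendsto_id : ∀ ε' > (0 : K),
      ∀ᶠ b in 𝓝 (x i), |b - x i| < ε')
    obtain ⟨t, ht, hto, hxt⟩ := mem_nhds_iff.1 hev
    obtain ⟨ρ, hρ, hρt⟩ : ∃ ρ : K, 0 < ρ ∧ {s | |s - x i| < ρ} ⊆ t := by
      have hmem : t ∈ 𝓝 (x i) := hto.mem_nhds hxt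
      obtain ⟨l, u, hlu, hsub⟩ := mem_nhds_iff_exists_Ioo_subset.1 hmem
      refine ⟨min (x i - l) (u - x i), lt_min (sub_pos.2 hlu.1) (sub_pos.2 hlu.2), fun s hs => ?_⟩
      have h1 := abs_sub_lt_iff.1 (hs.trans_le (min_le_left _ _))
      have h2 := abs_sub_lt_iff.1 (hs.trans_le (min_le_right _ _))
      exact hsub ⟨by linarith [h1.2], by linarith [h2.1]⟩
    exact ⟨ρ, hρ, fun s hs hsne => ht (hρt hs) hsne⟩
  refine ⟨δ, hδ, fun h hh => ?_⟩
  have hsum : ∑ j, (Pi.single i φ' : Fin n → K) j * h j = φ' * h i := by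
    rw [Finset.sum_eq_single i]
    · simp
    · intro j _ hj; simp [hj]
    · intro hh'; exact absurd (Finset.mem_univ i) hh'
  rw [hsum]
  simp only [Pi.add_apply]
  rcases eq_or_ne (h i) 0 with h0 | h0
  · rw [h0, add_zero, sub_self, mul_zero, sub_zero, abs_zero]
    exact mul_nonneg hε.le (Finset.sum_nonneg fun j _ => abs_nonneg _)
  · have hs : x i + h i ≠ x i := fun h' => h0 (by linarith)
    have hkey := hδε (x i + h i) (by simpa using hh i) hs
    rw [add_sub_cancel_left] at hkey
    have hpos : 0 < |h i| := abs_pos.2 h0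
    have hmul : |φ (x i + h i) - φ (x i) - φ' * h i| < ε * |h i| := by
      have := mul_lt_mul_of_pos_right hkey hpos
      rw [← abs_mul, sub_mul, div_mul_cancel₀ _ h0] at this
      simpa [mul_comm] using this
    exact hmul.le.trans (mul_le_mul_of_nonneg_left (abs_apply_le_sum_abs h i) hε.le)

/-! ### The product rule -/

omit [TopologicalSpace K] [OrderTopology K] in
/-- **The product rule** for the norm-free derivative on `Kⁿ`. [folklore] -/
theorem HasLinDerivAt.mul {f₁ f₂ : (Fin n → K) → K} {g₁ g₂ : Fin n → K} {x : Fin n → K}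
    (h₁ : HasLinDerivAt f₁ g₁ x) (h₂ : HasLinDerivAt f₂ g₂ x) :
    HasLinDerivAt (fun y => f₁ y * f₂ y) (fun i => f₁ x * g₂ i + f₂ x * g₁ i) x := by
  intro ε hε
  -- constants
  set A : K := |f₁ x| with hA
  set B : K := |f₂ x| with hB
  set G₁ : K := ∑ i, |g₁ i| with hG₁
  set G₂ : K := ∑ i, |g₂ i| with hG₂
  have hA0 : 0 ≤ A := abs_nonneg _
  have hB0 : 0 ≤ B := abs_nonneg _
  have hG₁0 : 0 ≤ G₁ := Finset.sum_nonneg fun i _ => abs_nonneg _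
  have hG₂0 : 0 ≤ G₂ := Finset.sum_nonneg fun i _ => abs_nonneg _
  set D : K := A + B + G₁ + 1 with hD
  have hDpos : 0 < D := by rw [hD]; linarith
  set η : K := min (ε / D) 1 with hη
  have hηpos : 0 < η := lt_min (div_pos hε hDpos) one_pos
  have hη1 : η ≤ 1 := min_le_right _ _
  have hηD : η * D ≤ ε := by
    have : η ≤ ε / D := min_le_left _ _
    calc η * D ≤ ε / D * D := mul_le_mul_of_nonneg_right this hDpos.le
      _ = ε := div_mul_cancel₀ _ hDpos.ne'
  obtain ⟨δ₁, hδ₁, hf₁⟩ := h₁ η hηpos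
  obtain ⟨δ₂, hδ₂, hf₂⟩ := h₂ η hηpos
  have hden : 0 < (G₂ + 1) * ((n : K) + 1) := mul_pos (by linarith) (by exact_mod_cast Nat.succ_pos n)
  set δ₃ : K := η / ((G₂ + 1) * (n + 1)) with hδ₃
  have hδ₃pos : 0 < δ₃ := div_pos hηpos hden
  refine ⟨min (min δ₁ δ₂) δ₃, lt_min (lt_min hδ₁ hδ₂) hδ₃pos, fun h hh => ?_⟩
  have hh₁ : ∀ i, |h i| < δ₁ := fun i => (hh i).trans_le ((min_le_left _ _).trans (min_le_left _ _))
  have hh₂ : ∀ i, |h i| < δ₂ := fun i => (hh i).trans_le ((min_le_left _ _).trans (min_le_right _ _))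
  have hh₃ : ∀ i, |h i| < δ₃ := fun i => (hh i).trans_le (min_le_right _ _)
  set S : K := ∑ i, |h i| with hS
  have hS0 : 0 ≤ S := Finset.sum_nonneg fun i _ => abs_nonneg _
  have e₁ := hf₁ h hh₁
  have e₂ := hf₂ h hh₂
  have hlin₁ : |∑ i, g₁ i * h i| ≤ G₁ * S := by
    refine (abs_sum_mul_le _ _).trans ?_
    rw [hG₁, Finset.sum_mul]
    exact Finset.sum_le_sum fun i _ => mul_le_mul_of_nonneg_left (abs_apply_le_sum_abs h i)
      (abs_nonneg _)
  have hlin₂ : |∑ i, g₂ i * h i| ≤ G₂ * S := by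
    refine (abs_sum_mul_le _ _).trans ?_
    rw [hG₂, Finset.sum_mul]
    exact Finset.sum_le_sum fun i _ => mul_le_mul_of_nonneg_left (abs_apply_le_sum_abs h i)
      (abs_nonneg _)
  -- the increment of `f₂` is at most `η`
  have hSle : S ≤ n * δ₃ := by
    calc S = ∑ i, |h i| := rfl
      _ ≤ ∑ _i : Fin n, δ₃ := Finset.sum_le_sum fun i _ => (hh₃ i).le
      _ = n * δ₃ := by simp
  have hincr₂ : |f₂ (x + h) - f₂ x| ≤ (G₂ + 1) * S := by
    have htri := abs_add_le (f₂ (x + h) - f₂ x - ∑ i, g₂ i * h i) (∑ i, g₂ i * h i)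
    rw [sub_add_cancel] at htri
    have e₂' : |f₂ (x + h) - f₂ x - ∑ i, g₂ i * h i| ≤ 1 * S :=
      e₂.trans (mul_le_mul_of_nonneg_right hη1 hS0)
    linarith
  have hsmall₂ : |f₂ (x + h) - f₂ x| ≤ η := by
    refine hincr₂.trans ?_
    calc (G₂ + 1) * S ≤ (G₂ + 1) * (n * δ₃) := mul_le_mul_of_nonneg_left hSle (by linarith)
      _ = η * (n / (n + 1)) := by rw [hδ₃]; field_simp
      _ ≤ η * 1 := by
          refine mul_le_mul_of_nonneg_left ?_ hηpos.le
          rw [div_le_one (by exact_mod_cast Nat.succ_pos n)]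
          linarith
      _ = η := mul_one η
  have hB' : |f₂ (x + h)| ≤ B + 1 := by
    have := abs_sub_abs_le_abs_sub (f₂ (x + h)) (f₂ x)
    linarith
  -- algebra: the remainder of the product
  have hdecomp : f₁ (x + h) * f₂ (x + h) - f₁ x * f₂ x - ∑ i, (f₁ x * g₂ i + f₂ x * g₁ i) * h i =
      f₁ x * (f₂ (x + h) - f₂ x - ∑ i, g₂ i * h i) +
        f₂ (x + h) * (f₁ (x + h) - f₁ x - ∑ i, g₁ i * h i) +
        (f₂ (x + h) - f₂ x) * ∑ i, g₁ i * h i := by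
    have hs : ∑ i, (f₁ x * g₂ i + f₂ x * g₁ i) * h i =
        f₁ x * ∑ i, g₂ i * h i + f₂ x * ∑ i, g₁ i * h i := by
      rw [Finset.mul_sum, Finset.mul_sum, ← Finset.sum_add_distrib]
      exact Finset.sum_congr rfl fun i _ => by ring
    rw [hs]
    ring
  rw [hdecomp]
  calc |f₁ x * (f₂ (x + h) - f₂ x - ∑ i, g₂ i * h i) +
        f₂ (x + h) * (f₁ (x + h) - f₁ x - ∑ i, g₁ i * h i) +
        (f₂ (x + h) - f₂ x) * ∑ i, g₁ i * h i|
      ≤ |f₁ x * (f₂ (x + h) - f₂ x - ∑ i, g₂ i * h i)| +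
        |f₂ (x + h) * (f₁ (x + h) - f₁ x - ∑ i, g₁ i * h i)| +
        |(f₂ (x + h) - f₂ x) * ∑ i, g₁ i * h i| := abs_add_three _ _ _
    _ ≤ A * (η * S) + (B + 1) * (η * S) + η * (G₁ * S) := by
        rw [abs_mul, abs_mul, abs_mul]
        refine add_le_add (add_le_add ?_ ?_) ?_
        · exact mul_le_mul_of_nonneg_left e₂ hA0
        · exact mul_le_mul hB' e₁ (abs_nonneg _) (by linarith)
        · exact mul_le_mul hsmall₂ hlin₁ (abs_nonneg _) hηpos.le
    _ = η * D * S := by rw [hD]; ring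
    _ ≤ ε * S := mul_le_mul_of_nonneg_right hηD hS0

omit [TopologicalSpace K] [OrderTopology K] in
/-- Difference rule. [folklore] -/
theorem HasLinDerivAt.sub {f₁ f₂ : (Fin n → K) → K} {g₁ g₂ : Fin n → K} {x : Fin n → K}
    (h₁ : HasLinDerivAt f₁ g₁ x) (h₂ : HasLinDerivAt f₂ g₂ x) :
    HasLinDerivAt (fun y => f₁ y - f₂ y) (g₁ - g₂) x := by
  have h := h₁.add (h₂.const_mul (-1))
  have hfun : (fun y => f₁ y + -1 * f₂ y) = fun y => f₁ y - f₂ y := by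
    funext y; ring
  have hgrad : (g₁ + fun i => -1 * g₂ i) = g₁ - g₂ := by
    funext i; simp; ring
  rw [hfun, hgrad] at h
  exact h

end Literature.ModelTheory.ExponentialFields
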